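import Literature.AlgebraicGeometry.Resolution.HenselLift
import Literature.AlgebraicGeometry.Resolution.ValuationConjugation
import Literature.AlgebraicGeometry.Resolution.ValuedFunctionFieldsLemmas
import Literature.AlgebraicGeometry.Resolution.TranscendentallyImmediate
import HarnessLib

/-!
# Henselian (unique extension) implies Hensel's Lemma — proof of `Kuhlmann2010HenselsLemma`

Topic: `Literature/AlgebraicGeometry/Resolution` (valued function fields). DISCHARGE of the
named fact `Kuhlmann2010HenselsLemma` of `HenselLift.lean` = F.-V. Kuhlmann, *Elimination of
ramification I: The generalized stability theorem*, Trans. AMS 362 (2010) 5697–5727 =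
arXiv:1003.5678, §1.1 (p. 3 of the arXiv text):

> If `K^h = K`, then `(K,v)` is called henselian. This holds if and only if the extension of
> `v` from `K` to every algebraic extension field is unique (implying that `g = 1` in (1)), or
> equivalently, if and only if `(K,v)` satisfies Hensel's Lemma (see [R], [W] for various
> forms of Hensel's Lemma).

in the direction the tree uses: a valued field `(K, O)` with a unique extension of `O` to every
algebraic extension (`IsHenselianField`, `Henselization.lean`) has a valuation ring `O`
satisfying Hensel's Lemma in Mathlib's form (`HenselianLocalRing O`: a monic `f ∈ O[X]` with
`f(a₀) ∈ 𝔪`, `f'(a₀) ∈ O^×` has a root `a ≡ a₀ mod 𝔪`). This is the input of the lifting step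
of the proof of Lemma 5.5 (`exists_root_lift_of_henselianLocalRing`, `HenselLift.lean`; p. 19:
"Using Hensel's Lemma, we lift `η` to an element `y' ∈ F`").

## Proof (classical; e.g. [En] = O. Endler, *Valuation theory* (1972), §16, or [R])

Extend `O` to a valuation ring `W` of the algebraic closure `Ω = K̃` (Chevalley,
`exists_valuationSubring_comap_eq`). The monic `f` splits in `Ω` with all roots in `W`
(integrality); since `v(f(a₀)) = ∏ v(a₀ - ρ) < 1`, some root `α` has `v(a₀ - α) < 1`. Write
`f = (X - α)·g` over `W`; from `f'(a₀) = g(a₀) + (a₀ - α)g'(a₀) ∈ W^×` we get `g(a₀) ∈ W^×`.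
By uniqueness of the extension, every `σ ∈ Aut(Ω|K)` stabilises `W`, hence its maximal ideal;
so `σα` is a root of `f` with `σα ≡ a₀`, and if `σα ≠ α` then `g(σα) = 0` although
`g(σα) ≡ g(a₀) ≢ 0` — thus `σα = α` for all `σ`. As `Ω|K` is normal, every root of the minimal
polynomial `m` of `α` is a conjugate `σα = α`, so `m = (X - α)^d` in `Ω[X]`; but `α` is a
simple root of `f` (`f'(α) ≡ f'(a₀)` is a unit) and `m ∣ f`, so `d = 1`, i.e. `α ∈ K`, and
then `α ∈ W ∩ K = O`, `f(α) = 0`, `α ≡ a₀ mod 𝔪_O`.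

## Content (everything PROVED)

* `mem_maximalIdeal_iff_comapInclusion_mem` — the inclusion `W ∩ K → W` (`comapInclusion`,
  a local homomorphism, `TranscendentallyImmediate.lean`) detects the maximal ideal.
* `IsHenselianField.hensel` — Hensel's Lemma (simple-root form) for `(K, O)` henselian in the
  uniqueness sense.
* `IsHenselianField.henselianLocalRing`, `Kuhlmann2010HenselsLemma_holds` — the discharge.

## Sources

* F.-V. Kuhlmann, Trans. AMS 362 (2010) = arXiv:1003.5678, §1.1. [En] O. Endler, *Valuation
  theory*, Springer 1972, §16–17; [R] P. Ribenboim, *Théorie des valuations* (1968).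
-/

noncomputable section

open IsLocalRing Polynomial
open scoped Pointwise

namespace Literature.AlgebraicGeometry.Resolution

universe u

/-! ### The inclusion `W ∩ K → W` -/

section Restriction

variable {K Ω : Type u} [Field K] [Field Ω] [Algebra K Ω] (W : ValuationSubring Ω)

/-- `comapInclusion W : W ∩ K → W` is injective. [folklore] -/
theorem comapInclusion_injective : Function.Injective (comapInclusion (F := K) W) := by
  intro a b h
  have h' : algebraMap K Ω a = algebraMap K Ω b := congrArg (fun w : W => (w : Ω)) h
  exact Subtype.ext ((algebraMap K Ω).injective h')

/-- **`W ∩ K → W` detects the maximal ideal** (it is a local homomorphism,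
`isLocalHom_comapInclusion`). [folklore] -/
theorem mem_maximalIdeal_iff_comapInclusion_mem (c : W.comap (algebraMap K Ω)) :
    c ∈ maximalIdeal (W.comap (algebraMap K Ω)) ↔ comapInclusion W c ∈ maximalIdeal W := by
  rw [IsLocalRing.mem_maximalIdeal, IsLocalRing.mem_maximalIdeal, mem_nonunits_iff,
    mem_nonunits_iff, isUnit_map_iff]

/-- Evaluation commutes with `comapInclusion`. [folklore] -/
theorem comapInclusion_eval (p : Polynomial (W.comap (algebraMap K Ω)))
    (c : W.comap (algebraMap K Ω)) :
    comapInclusion W (p.eval c) = (p.map (comapInclusion W)).eval (comapInclusion W c) := by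
  rw [eval_map, eval₂_at_apply]

/-- Evaluation in `W` versus evaluation in `Ω`. [folklore] -/
theorem coe_eval_valuationSubring (q : Polynomial W) (w : W) :
    ((q.eval w : W) : Ω) = (q.map (algebraMap W Ω)).eval (w : Ω) := by
  rw [eval_map]
  change _ = eval₂ (algebraMap W Ω) (algebraMap W Ω w) q
  rw [eval₂_at_apply]
  rfl

/-- Reduction modulo the maximal ideal commutes with evaluation. [folklore] -/
theorem residue_eval_valuationSubring (q : Polynomial W) (w : W) :
    residue W (q.eval w) = (q.map (residue W)).eval (residue W w) := by
  rw [eval_map, eval₂_at_apply]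

end Restriction

/-! ### Hensel's Lemma from the uniqueness of extensions -/

section Hensel

variable {K : Type u} [Field K] {O : ValuationSubring K}

/-- **Hensel's Lemma for a henselian field (uniqueness form)** (Kuhlmann 2010, §1.1: unique
extension to every algebraic extension "or equivalently, if and only if `(K,v)` satisfies
Hensel's Lemma"): for `(K, O)` with `IsHenselianField K O`, a monic `f ∈ O[X]` and `a₀ ∈ O`
with `f(a₀) ∈ 𝔪_O` and `f'(a₀)` a unit, there is a root `a ∈ O` of `f` with `a - a₀ ∈ 𝔪_O`.
PROVED (module docstring). [cite: Kuhlmann2010, Section 1.1] -/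
theorem IsHenselianField.hensel (hK : IsHenselianField K O) (f : Polynomial O) (hf : f.Monic)
    (a₀ : O) (h₁ : f.eval a₀ ∈ maximalIdeal O) (h₂ : IsUnit (f.derivative.eval a₀)) :
    ∃ a : O, f.IsRoot a ∧ a - a₀ ∈ maximalIdeal O := by
  classical
  -- an extension `W` of `O` to the algebraic closure
  obtain ⟨W, hW⟩ := exists_valuationSubring_comap_eq (Ω := AlgebraicClosure K) O
  subst hW
  -- the polynomial over `W`, over `K` and over `Ω`
  set fW : Polynomial W := f.map (comapInclusion (F := K) W) with hfW
  set fK : Polynomial K := f.map (algebraMap _ K) with hfK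
  set fΩ : Polynomial (AlgebraicClosure K) := fK.map (algebraMap K (AlgebraicClosure K)) with hfΩ
  have hfWΩ : fW.map (algebraMap W (AlgebraicClosure K)) = fΩ := by
    rw [hfW, hfΩ, hfK, Polynomial.map_map, Polynomial.map_map]
    congr 1
  have hmonW : fW.Monic := hf.map _
  have hmonΩ : fΩ.Monic := (hf.map _).map _
  have hfΩ0 : fΩ ≠ 0 := hmonΩ.ne_zero
  have hevalΩ : ∀ x : AlgebraicClosure K, fΩ.eval x = aeval x fK := fun x => by
    rw [hfΩ, eval_map, aeval_def]
  -- `a₀` in `W`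
  set a₀W : W := comapInclusion (F := K) W a₀ with ha₀W
  have ha₀Ω : (a₀W : AlgebraicClosure K) = algebraMap K (AlgebraicClosure K) a₀ := rfl
  have h₁W : fW.eval a₀W ∈ maximalIdeal W := by
    rw [hfW, ha₀W, ← comapInclusion_eval]
    exact (mem_maximalIdeal_iff_comapInclusion_mem W _).mp h₁
  have h₂W : IsUnit (fW.derivative.eval a₀W) := by
    rw [hfW, derivative_map, ha₀W, ← comapInclusion_eval]
    exact (isUnit_map_iff (comapInclusion (F := K) W) _).mpr h₂
  -- the roots of `fΩ` lie in `W`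
  have hsplit : fΩ.Splits := IsAlgClosed.splits fΩ
  have hprod := hsplit.eq_prod_roots_of_monic hmonΩ
  have hrootsW : ∀ b ∈ fΩ.roots, b ∈ W := by
    intro b hb
    have hb' : fΩ.eval b = 0 := (mem_roots hfΩ0).mp hb
    refine mem_of_isIntegral_of_le (S := W.toSubring) le_rfl ⟨fW, hmonW, ?_⟩
    rw [← eval_map]
    rw [← hfWΩ] at hb'
    exact hb'
  -- a root `α` with `v(a₀ - α) < 1`
  have hva₀ : W.valuation (fΩ.eval (a₀W : AlgebraicClosure K)) < 1 := by
    have h3 : fΩ.eval (a₀W : AlgebraicClosure K) = ((fW.eval a₀W : W) : AlgebraicClosure K) := by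
      rw [coe_eval_valuationSubring, hfWΩ]
    rw [h3, ← ValuationSubring.valuation_lt_one_iff]
    exact h₁W
  obtain ⟨α, hαroot, hvα⟩ :
      ∃ α ∈ fΩ.roots, W.valuation ((a₀W : AlgebraicClosure K) - α) < 1 := by
    by_contra hall
    push Not at hall
    have hone : W.valuation (fΩ.eval (a₀W : AlgebraicClosure K)) = 1 := by
      conv_lhs => rw [hprod]
      rw [eval_multiset_prod, Multiset.map_map, map_multiset_prod, Multiset.map_map]
      refine Multiset.prod_eq_one fun x hx => ?_
      obtain ⟨b, hb, rfl⟩ := Multiset.mem_map.mp hx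
      simp only [Function.comp_apply, eval_sub, eval_X, eval_C]
      exact le_antisymm ((W.valuation_le_one_iff _).mpr (W.sub_mem a₀W.2 (hrootsW b hb)))
        (hall b hb)
    rw [hone] at hva₀
    exact lt_irrefl _ hva₀
  have hαW : α ∈ W := hrootsW α hαroot
  have hαfΩ : fΩ.eval α = 0 := (mem_roots hfΩ0).mp hαroot
  have hαfK : aeval α fK = 0 := by rw [← hevalΩ]; exact hαfΩ
  set αW : W := ⟨α, hαW⟩ with hαWdef
  have hαa₀ : αW - a₀W ∈ maximalIdeal W := by
    rw [ValuationSubring.valuation_lt_one_iff]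
    change W.valuation (α - (a₀W : AlgebraicClosure K)) < 1
    rwa [Valuation.map_sub_swap]
  have hresα : residue W αW = residue W a₀W := by
    rw [← sub_eq_zero, ← map_sub, residue_eq_zero_iff]
    exact hαa₀
  -- `fW = (X - α)·g` with `g(a₀)` a unit
  have hrootW : fW.IsRoot αW := by
    change fW.eval αW = 0
    apply Subtype.val_injective
    rw [coe_eval_valuationSubring, hfWΩ]
    exact hαfΩ
  set g : Polynomial W := fW /ₘ (X - C αW) with hg
  have hfg : (X - C αW) * g = fW := mul_divByMonic_eq_iff_isRoot.mpr hrootW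
  have hderiv : fW.derivative = g + (X - C αW) * g.derivative := by
    conv_lhs => rw [← hfg]
    rw [derivative_mul, derivative_X_sub_C, one_mul]
  have hgunit : IsUnit (g.eval a₀W) := by
    have h3 : fW.derivative.eval a₀W = g.eval a₀W + (a₀W - αW) * g.derivative.eval a₀W := by
      rw [hderiv, eval_add, eval_mul, eval_sub, eval_X, eval_C]
    by_contra hnu
    have hm1 : g.eval a₀W ∈ maximalIdeal W := (IsLocalRing.mem_maximalIdeal _).mpr hnu
    have hm2 : (a₀W - αW) * g.derivative.eval a₀W ∈ maximalIdeal W := by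
      refine Ideal.mul_mem_right _ _ ?_
      rw [← neg_sub]
      exact neg_mem hαa₀
    have h4 : fW.derivative.eval a₀W ∈ maximalIdeal W := by
      rw [h3]
      exact Ideal.add_mem _ hm1 hm2
    exact (IsLocalRing.mem_maximalIdeal _).mp h4 h₂W
  -- every `K`-automorphism of `Ω` fixes `α`
  have hfix : ∀ σ : AlgebraicClosure K ≃ₐ[K] AlgebraicClosure K, σ α = α := by
    intro σ
    have hσW : σ • W = W :=
      hK (AlgebraicClosure K) inferInstance (σ • W) W (comap_smul_algEquiv σ W) rfl
    by_contra hne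
    -- `σ α` lies in `W`, is a root of `fΩ`, and is congruent to `a₀`
    have hσαW : σ α ∈ W := by
      have h5 := ValuationSubring.smul_mem_pointwise_smul_iff (g := σ) (S := W) (x := α)
      rw [hσW, AlgEquiv.smul_def] at h5
      exact h5.mpr hαW
    have hσroot : fΩ.eval (σ α) = 0 := by
      rw [hevalΩ]
      change aeval ((σ : AlgebraicClosure K →ₐ[K] AlgebraicClosure K) α) fK = 0
      rw [aeval_algHom_apply, hαfK, map_zero]
    have hσclose : W.valuation (σ α - (a₀W : AlgebraicClosure K)) < 1 := by
      have h5 : σ α - (a₀W : AlgebraicClosure K) = σ • (α - (a₀W : AlgebraicClosure K)) := by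
        rw [AlgEquiv.smul_def, map_sub, ha₀Ω, AlgEquiv.commutes]
      have h6 := valuation_smul_lt_one_iff σ W (σ • (α - (a₀W : AlgebraicClosure K)))
      rw [hσW, inv_smul_smul] at h6
      rw [h5, h6, Valuation.map_sub_swap]
      exact hvα
    set βW : W := ⟨σ α, hσαW⟩ with hβWdef
    have hβroot : fW.eval βW = 0 := by
      apply Subtype.val_injective
      rw [coe_eval_valuationSubring, hfWΩ]
      exact hσroot
    have hgβ : g.eval βW = 0 := by
      have h5 : (βW - αW) * g.eval βW = 0 := by
        have h6 := hβroot
        rw [← hfg, eval_mul, eval_sub, eval_X, eval_C] at h6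
        exact h6
      rcases mul_eq_zero.mp h5 with h6 | h6
      · exfalso
        exact hne (congrArg Subtype.val (sub_eq_zero.mp h6))
      · exact h6
    have hresβ : residue W βW = residue W a₀W := by
      rw [← sub_eq_zero, ← map_sub, residue_eq_zero_iff, ValuationSubring.valuation_lt_one_iff]
      exact hσclose
    have hresg : residue W (g.eval βW) = residue W (g.eval a₀W) := by
      rw [residue_eval_valuationSubring, residue_eval_valuationSubring, hresβ]
    have h7 : residue W (g.eval a₀W) ≠ 0 := (residue_ne_zero_iff_isUnit _).mpr hgunit
    apply h7
    rw [← hresg, hgβ, map_zero]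
  -- the minimal polynomial of `α` over `K` has the single root `α`
  have hαint : IsIntegral K α := (Algebra.IsAlgebraic.isAlgebraic (R := K) α).isIntegral
  set m : Polynomial K := minpoly K α with hm
  set mΩ : Polynomial (AlgebraicClosure K) := m.map (algebraMap K (AlgebraicClosure K)) with hmΩ
  have hmΩ0 : mΩ ≠ 0 := ((minpoly.monic hαint).map _).ne_zero
  have hmroots : ∀ β ∈ mΩ.roots, β = α := by
    intro β hβ
    have hβ' : aeval β m = 0 := by
      rw [aeval_def, ← eval_map]
      exact (mem_roots hmΩ0).mp hβ
    have hmin : minpoly K β = minpoly K α :=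
      (minpoly.eq_of_irreducible_of_monic (minpoly.irreducible hαint) hβ' (minpoly.monic hαint)).symm
    obtain ⟨σ, hσ⟩ := MulAction.mem_orbit_iff.mp
      ((Normal.minpoly_eq_iff_mem_orbit (F := K) (E := AlgebraicClosure K)).mp hmin)
    rw [← hσ, AlgEquiv.smul_def, hfix]
  have hcount : mΩ.rootMultiplicity α = m.natDegree := by
    rw [← count_roots, Multiset.count_eq_card.mpr fun x hx => (hmroots x hx).symm,
      ← (IsAlgClosed.splits mΩ).natDegree_eq_card_roots, hmΩ, natDegree_map]
  -- `α` is a simple root of `fΩ`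
  have hfαunit : IsUnit (fW.derivative.eval αW) := by
    by_contra hnu
    have hm1 : fW.derivative.eval αW ∈ maximalIdeal W := (IsLocalRing.mem_maximalIdeal _).mpr hnu
    have h5 : residue W (fW.derivative.eval a₀W) = 0 := by
      rw [residue_eval_valuationSubring, ← hresα, ← residue_eval_valuationSubring,
        residue_eq_zero_iff]
      exact hm1
    exact (residue_ne_zero_iff_isUnit _).mpr h₂W h5
  have hfΩ'α : fΩ.derivative.eval α ≠ 0 := by
    intro h0
    apply hfαunit.ne_zero
    apply Subtype.val_injective
    rw [coe_eval_valuationSubring, ← derivative_map, hfWΩ]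
    exact h0
  have hdeg : m.natDegree = 1 := by
    have hpos : 0 < m.natDegree := minpoly.natDegree_pos hαint
    by_contra hne1
    have hlt : 1 < mΩ.rootMultiplicity α := by
      rw [hcount]
      omega
    obtain ⟨hr0, hder⟩ := (one_lt_rootMultiplicity_iff_isRoot hmΩ0).mp hlt
    have hdvd : mΩ ∣ fΩ := by
      rw [hmΩ, hfΩ]
      exact Polynomial.map_dvd _ (minpoly.dvd K α hαfK)
    obtain ⟨q, hq⟩ := hdvd
    apply hfΩ'α
    rw [hq, derivative_mul, eval_add, eval_mul, eval_mul, hder.eq_zero, hr0.eq_zero, zero_mul,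
      zero_mul, add_zero]
  obtain ⟨a, ha⟩ := RingHom.mem_range.mp (minpoly.natDegree_eq_one_iff.mp hdeg)
  -- conclusion: `a ∈ O` is the root
  have haO : a ∈ W.comap (algebraMap K (AlgebraicClosure K)) := by
    rw [ValuationSubring.mem_comap, ha]
    exact hαW
  have hιa : comapInclusion (F := K) W ⟨a, haO⟩ = αW := Subtype.ext ha
  refine ⟨⟨a, haO⟩, ?_, ?_⟩
  · change f.eval ⟨a, haO⟩ = 0
    apply comapInclusion_injective W
    rw [map_zero, comapInclusion_eval, hιa, ← hfW]
    exact hrootW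
  · rw [mem_maximalIdeal_iff_comapInclusion_mem, map_sub, hιa, ← ha₀W]
    exact hαa₀

/-- **A henselian field (uniqueness form) has a henselian valuation ring** (Mathlib's
`HenselianLocalRing`). PROVED. [cite: Kuhlmann2010, Section 1.1] -/
theorem IsHenselianField.henselianLocalRing (hK : IsHenselianField K O) : HenselianLocalRing O :=
  { is_henselian := fun f hf a₀ h₁ h₂ => hK.hensel f hf a₀ h₁ h₂ }

end Hensel

/-- **Kuhlmann 2010, §1.1: henselian (unique extension of the valuation to every algebraic
extension) ⇒ Hensel's Lemma** — DISCHARGE of the named fact `Kuhlmann2010HenselsLemma`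
(`HenselLift.lean`). [cite: Kuhlmann2010, Section 1.1] -/
theorem Kuhlmann2010HenselsLemma_holds : Kuhlmann2010HenselsLemma.{u} :=
  fun _K _ _O hK => hK.henselianLocalRing

end Literature.AlgebraicGeometry.Resolution
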